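import Summits.Ventures.Crystal3D.Theorems.StickyWulffConstantCoaxialWallLawClassCollapse
import Summits.Ventures.Crystal3D.Theorems.StickyWulffConstantCoaxialWallLawReadingDirections
import HarnessLib

/-!
# Mirror partners of a word class: `R_n '' img (Fw κ) = img (Fw ((Fw κ)⁻¹ n :: κ))` for ANY unit normal `n`
# (crux `CoaxialWallLaw`, stmt-Ventures-19481; brick (L1′)(b) of MODULE-CAPTURE-PLAN-g10 §6 for `stub_moduleCapture`)

HONEST FRAMING. Venture `Summits/Ventures/Crystal3D` (cell `crystal3d-full`); helper `--supports` the crux `CoaxialWallLaw`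
(stmt-Ventures-19481, `route-Ventures-StickyWulffConstant`), registered line 'CoaxialWallLawCertificates' (planner cf-p1).  Census-free
algebra; F-C1 not moved.  `…ReducedWordRigidity.image_basalMirror_fw` identifies the BASAL partner of a class as the class with the extra letter
`(Fw κ)⁻¹ e₃`; the generalized class collapse (eight standard dozens) needs the same for the INCLINED mirrors `reflectAt (inclinedNormal c) 0`:
* `reflection_map` — conjugation `R_n (G x) = G (R_{G⁻¹ n} x)` for a unit `n` and an isometry `G`;
* **`image_reflection_fw`** — `R_n '' img (S.Fw κ) = img (S.Fw ((S.Fw κ)⁻¹ n :: κ))` for every unit `n`;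
* `reflectAt_zero_eq_reflection` — `reflectAt n 0 = R_n` (unit `n`), hence **`image_reflectAt_inclined_fw`**: the inclined partner across
  `inclinedNormal c` of the class `κ` has the slot dozen of the class `(S.Fw κ)⁻¹ (inclinedNormal c) :: κ`;
* `isMenuLetter_symm_of_isMenuNormal` — the new letter `G⁻¹ n` is a unit model MENU letter exactly when `n` is a menu normal of `G`
  (`IsMenuNormal G n`), which is what reduced-word rigidity (`reduced_forall₂_of_foldl_image_eq`) requires of letters.
WHAT THIS IS NOT: not the table «which placement normals are menu normals of which standard dozen» (std_cases8), not the collapse; F-C1 not moved.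
-/

noncomputable section

namespace Summit.Ventures.Crystal3D.Theorems

open Summit.Ventures.Crystal3D Finset TailResidue
open scoped InnerProductSpace

/-- **Conjugation**: `R_n (G x) = G (R_{G⁻¹ n} x)` for a unit `n`. -/
theorem reflection_map (G : EuclideanSpace ℝ (Fin 3) ≃ₗᵢ[ℝ] EuclideanSpace ℝ (Fin 3)) {n : EuclideanSpace ℝ (Fin 3)} (hn : ‖n‖ = 1)
    (x : EuclideanSpace ℝ (Fin 3)) :
    (ℝ ∙ n)ᗮ.reflection (G x) = G (x - (2 * ⟪x, G.symm n⟫_ℝ) • G.symm n) := by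
  rw [reflection_unit_apply hn, map_sub, LinearIsometryEquiv.map_smul, LinearIsometryEquiv.apply_symm_apply,
    ← LinearIsometryEquiv.inner_map_map G x, LinearIsometryEquiv.apply_symm_apply]

/-- The pulled-back normal is a unit vector. -/
theorem norm_symm_unit (G : EuclideanSpace ℝ (Fin 3) ≃ₗᵢ[ℝ] EuclideanSpace ℝ (Fin 3)) {n : EuclideanSpace ℝ (Fin 3)} (hn : ‖n‖ = 1) :
    ‖G.symm n‖ = 1 := by
  rw [LinearIsometryEquiv.norm_map, hn]

/-- **The mirror partner of a word class is the class with one more letter**: `R_n '' img (S.Fw κ) = img (S.Fw ((S.Fw κ)⁻¹ n :: κ))`. -/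
theorem image_reflection_fw (S : PlateSystem) (κ : List (EuclideanSpace ℝ (Fin 3))) {n : EuclideanSpace ℝ (Fin 3)} (hn : ‖n‖ = 1) :
    ((ℝ ∙ n)ᗮ.reflection : EuclideanSpace ℝ (Fin 3) → EuclideanSpace ℝ (Fin 3)) ''
        ((S.Fw κ : EuclideanSpace ℝ (Fin 3) → EuclideanSpace ℝ (Fin 3)) '' ↑fccSlots) =
      (S.Fw ((S.Fw κ).symm n :: κ) : EuclideanSpace ℝ (Fin 3) → EuclideanSpace ℝ (Fin 3)) '' ↑fccSlots := by
  rw [Set.image_image]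
  refine Set.image_congr fun w _ => ?_
  rw [word_F_cons_apply (PlateSystem.fw_cons S) (norm_symm_unit (S.Fw κ) hn), reflection_map (S.Fw κ) hn]

/-- `reflectAt n 0` is the reflection across `nᗮ` for a unit `n`. -/
theorem reflectAt_zero_eq_reflection {n : EuclideanSpace ℝ (Fin 3)} (hn : ‖n‖ = 1) (x : EuclideanSpace ℝ (Fin 3)) :
    reflectAt n 0 x = (ℝ ∙ n)ᗮ.reflection x := by
  rw [reflectAt, sub_zero, reflection_unit_apply hn]

/-- **Inclined partners**: the image of a class dozen under the placement mirror `reflectAt (inclinedNormal c) 0` is the dozen of the class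
with the extra letter `(S.Fw κ)⁻¹ (inclinedNormal c)`. -/
theorem image_reflectAt_inclined_fw (S : PlateSystem) (κ : List (EuclideanSpace ℝ (Fin 3))) (c : Fin 6) :
    (reflectAt (inclinedNormal c) 0 : EuclideanSpace ℝ (Fin 3) → EuclideanSpace ℝ (Fin 3)) ''
        ((S.Fw κ : EuclideanSpace ℝ (Fin 3) → EuclideanSpace ℝ (Fin 3)) '' ↑fccSlots) =
      (S.Fw ((S.Fw κ).symm (inclinedNormal c) :: κ) : EuclideanSpace ℝ (Fin 3) → EuclideanSpace ℝ (Fin 3)) '' ↑fccSlots := by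
  have h : (reflectAt (inclinedNormal c) 0 : EuclideanSpace ℝ (Fin 3) → EuclideanSpace ℝ (Fin 3)) =
      ((ℝ ∙ inclinedNormal c)ᗮ.reflection : EuclideanSpace ℝ (Fin 3) → EuclideanSpace ℝ (Fin 3)) :=
    funext fun x => reflectAt_zero_eq_reflection (norm_inclinedNormal c) x
  rw [h]
  exact image_reflection_fw S κ (norm_inclinedNormal c)

/-- **The new letter is a menu letter iff the mirror normal is a menu normal of the frame**: `G⁻¹ n` is a unit model menu letter
(`∀ w ∈ fccSlots, ⟪w, G⁻¹ n⟫ ∈ {0, ±√(2/3)}`) when `IsMenuNormal G n`. -/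
theorem isMenuLetter_symm_of_isMenuNormal {G : EuclideanSpace ℝ (Fin 3) ≃ₗᵢ[ℝ] EuclideanSpace ℝ (Fin 3)} {n : EuclideanSpace ℝ (Fin 3)}
    (h : IsMenuNormal G n) :
    ‖G.symm n‖ = 1 ∧ ∀ w ∈ fccSlots, ⟪w, G.symm n⟫_ℝ = 0 ∨ ⟪w, G.symm n⟫_ℝ = Real.sqrt (2 / 3) ∨ ⟪w, G.symm n⟫_ℝ = -Real.sqrt (2 / 3) := by
  refine ⟨norm_symm_unit G h.1, fun w hw => ?_⟩
  rw [← LinearIsometryEquiv.inner_map_map G, LinearIsometryEquiv.apply_symm_apply]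
  exact h.2 w hw

/-- Conversely a unit model menu letter `μ` gives the menu normal `G μ` of `G`. -/
theorem isMenuNormal_map_of_menuLetter (G : EuclideanSpace ℝ (Fin 3) ≃ₗᵢ[ℝ] EuclideanSpace ℝ (Fin 3)) {μ : EuclideanSpace ℝ (Fin 3)}
    (h1 : ‖μ‖ = 1) (h2 : ∀ w ∈ fccSlots, ⟪w, μ⟫_ℝ = 0 ∨ ⟪w, μ⟫_ℝ = Real.sqrt (2 / 3) ∨ ⟪w, μ⟫_ℝ = -Real.sqrt (2 / 3)) :
    IsMenuNormal G (G μ) := by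
  refine ⟨by rw [LinearIsometryEquiv.norm_map, h1], fun w hw => ?_⟩
  rw [LinearIsometryEquiv.inner_map_map]
  exact h2 w hw

end Summit.Ventures.Crystal3D.Theorems

end
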